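import Summits.MatrixMultiplication.MatrixMultiplication.Theorems.AbelianSTPPCensusShapeCertVQDefs

/-!
# Abelian STPP census — kernel evaluation of the vQ certificate checker `ShapeCertVQ` (H: orders 359, root segments)

Cell mm-stpp, rung F-M1; successor kernel item VQ-CERT (T_E beyond 337 under vQ := vP ∧ E3⁺) in support of the closed crux item
stmt-MatrixMultiplication-19191; seat mm-stpp-vp-p2 (gen 1); support file (no definitions).  At the orders `357–359` one kernel
evaluation of `checkQ M` (2.2–2.6·10⁴ candidate visits) exceeds the gate's per-declaration budget (first submissions p531772/p532174
bounced after the full evaluation time), so the root's candidate walk is split into ROOT SEGMENTS `ShapeCertVQ.rootSegQ M i n`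
(`…ShapeCertVQDefs`: the root steps of candidates `i … i+n−1` of `candQ M`, each with its full continuation pool), sized ≤ 1.1·10⁴
visits from the seat's per-root-candidate profile (calc/segplan_357_359.txt); each segment is ONE `decide +kernel` theorem (no
`native_decide`, standard axioms, `Elab.async false`).  The per-order certificates `checkQ_357/358/359` are assembled from these segments
by `ShapeCertVQ.checkQ_of_root` / `rootSegQ_append` / `rootTail_nil` (`…ShapeCertVQSearch`) in the leaf file.
WHAT THIS IS NOT: Boolean evaluations; no statement about STPP families or `ω` by themselves.
-/

set_option linter.dupNamespace false -- `MatrixMultiplication.MatrixMultiplication` (summit = problem, D-0017)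
set_option autoImplicit false
set_option Elab.async false -- sequential kernel evaluations (memory high-water of one segment at a time)

namespace Summit.MatrixMultiplication.MatrixMultiplication.Theorems.ShapeCertVQ

set_option maxHeartbeats 0 in
/-- root segment of the vQ certificate at order `359`: candidates `0 … 48` (≈ 10745 candidate visits; kernel evaluation) -/
theorem rootSegQ_359_0 : rootSegQ 359 0 49 = true := by
  decide +kernel

set_option maxHeartbeats 0 in
/-- root segment of the vQ certificate at order `359`: candidates `49 … 673` (≈ 11000 candidate visits; kernel evaluation) -/
theorem rootSegQ_359_49 : rootSegQ 359 49 625 = true := by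
  decide +kernel

set_option maxHeartbeats 0 in
/-- root segment of the vQ certificate at order `359`: candidates `674 … 6105` (≈ 3872 candidate visits; kernel evaluation) -/
theorem rootSegQ_359_674 : rootSegQ 359 674 5432 = true := by
  decide +kernel

end Summit.MatrixMultiplication.MatrixMultiplication.Theorems.ShapeCertVQ
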